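import Literature.NumberTheory.GelbartRogawski1991.LocalUnitarySplittingDatum
import Literature.NumberTheory.Automorphic.UnitaryGroupSplitPlace
import HarnessLib

/-!
# The `U(J)(F_v)`-stable Lagrangian at a place of `F` that splits in `E`
# ([MoeglinVignerasWaldspurger1987, Chap. 2 III.1], type II pairs; used in [GelbartRogawski1991, §3.1])

Topic `NumberTheory/GelbartRogawski1991`; namespace
`Literature.NumberTheory.GelbartRogawski1991.UnitaryDualPair.LocalSplitting`.  KERNEL ONLY: definitions with bodies
and proved lemmas; no named fact, no `sorry`.

Setting of `LocalUnitarySplittingDatum`: `E/F` quadratic, `c ∈ Aut(E/F)`, `c δ = -δ ≠ 0`, `δ² = d`, a symmetric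
`T ∈ GL_N(F)`, `J = T ⊗ 1`, a finite place `v` of `F`, and a place `w ∣ v` of `E` with `c w ≠ w` (so `v` SPLITS in
`E`: the places over `v` are `w ≠ c⁻¹ w`, tree `PlacesOver.eq_or_eq_galInv`, and `E ⊗_F F_v = E_w × E_{c⁻¹ w}`).
Let `e = e_w ∈ E ⊗ F_v = Π_{w' ∣ v} E_{w'}` be the idempotent of the factor `E_w` (`splitIdem`).  Then
`(c ⊗ 1)(e) · e = 0` and `e + (c ⊗ 1)(e) = 1`, and the image under the quadratic coordinates
`reIm : (E ⊗ F_v)ᴺ ≃ F_vᴺ × F_vᴺ` of the `E ⊗ F_v`-submodule `e · (E ⊗ F_v)ᴺ` is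

* a LAGRANGIAN of the local symplectic space `(𝕎_v, Im h)` of `LocalUnitarySplittingDatum`
  (`splitLagrangian`, `splitLagrangian_orthogonal_eq`: isotropic because `Im h(e x, e y) = Im((c ⊗ 1)(e) e h(x, y)) = 0`,
  maximal because `h` is non-degenerate and `e + (c ⊗ 1)(e) = 1`), and
* STABLE under `ι(U(J)(F_v))` (`splitLagrangian_map_iota`: `U(J)(F_v)` acts `E ⊗ F_v`-linearly).

This is the polarisation `𝕎 = X₁ ⊗ X₂ ⊕ (X₁ ⊗ X₂)^*` of a type II pair `(GL(X₁), GL(X₂))` of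
[MoeglinVignerasWaldspurger1987, Chap. 2 III.1] in the case `U(J)(F_v) ≅ GL_N(F_v)` of a split place; with the
stabiliser principle of `Weil1964/LocalLerayCocycleStabiliser` it trivialises the Leray cocycle on `ι(U(J)(F_v))` at every
split place (the split-place half of [Kudla1994, Thm 3.1] / [GelbartRogawski1991, Prop. 3.1.1]).  Packaged:
`exists_stable_lagrangian_of_split`.

Written for the kernel construction of the cited input `hGRU` of the Hodge-CM period-theorem package (stage-1 cell
`pub-hodgecm`, seat GR-1, 2026-08-21); nothing here is a claim of the manuscripts adjudicated by that cell.

## References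

* C. Mœglin, M.-F. Vignéras, J.-L. Waldspurger, LNM 1291 (1987), Chap. 2 III.1 [MoeglinVignerasWaldspurger1987].
* S. Gelbart, J. Rogawski, Invent. Math. 105 (1991) 445–472, §3.1 [GelbartRogawski1991].
* S. S. Kudla, Israel J. Math. 87 (1994) 361–401, Thm 3.1 [Kudla1994].
-/

set_option autoImplicit false

noncomputable section

open NumberField IsDedekindDomain Matrix
open Literature.RepresentationTheory.HeisenbergGroup
open Literature.NumberTheory.Automorphic Literature.NumberTheory.Automorphic.UnitaryGroup
open Literature.NumberTheory.Automorphic.UnitaryGroup.QuadraticCoordinates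

namespace Literature.NumberTheory.GelbartRogawski1991.UnitaryDualPair.LocalSplitting

variable (F : Type) [Field F] [NumberField F] (E : Type) [Field E] [NumberField E] [Algebra F E]
  [Algebra.IsQuadraticExtension F E] (c : E ≃ₐ[F] E) (N : ℕ)
  {δ : E} (hcδ : c δ = -δ) (hδ : δ ≠ 0) {d : F} (hd : δ * δ = algebraMap F E d)
  (T : Matrix (Fin N) (Fin N) F)
  {J : Matrix (Fin N) (Fin N) E} (hJ : J = T.map (algebraMap F E))
  (v : HeightOneSpectrum (𝓞 F))

local notation "K" => v.adicCompletion F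
local notation "S" => LocalRing E v
set_option quotPrecheck false in
local notation "Ψv" => (quadraticLocalEquiv E v c hcδ hδ).toLinearEquiv.toAddEquiv

/-! ## §1 The idempotent `e_w` of a factor `E_w ⊂ E ⊗ F_v` -/

/-- the idempotent `e_w ∈ E ⊗ F_v = Π_{w' ∣ v} E_{w'}` cutting out the factor `E_w`. [folklore] -/
def splitIdem (w : PlacesOver E v) : S := fun w' => open scoped Classical in if w' = w then 1 else 0

omit [NumberField F] [Algebra.IsQuadraticExtension F E] in
/-- unfolding. [folklore] -/
private theorem splitIdem_apply (w w' : PlacesOver E v) : splitIdem F E v w w' = open scoped Classical in if w' = w then 1 else 0 := rfl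

omit [NumberField F] [Algebra.IsQuadraticExtension F E] in
/-- `e_w(w) = 1`. [folklore] -/
@[simp] private theorem splitIdem_apply_self (w : PlacesOver E v) : splitIdem F E v w w = 1 := by simp [splitIdem]

omit [NumberField F] [Algebra.IsQuadraticExtension F E] in
/-- `e_w(w') = 0` for `w' ≠ w`. [folklore] -/
private theorem splitIdem_apply_ne {w w' : PlacesOver E v} (h : w' ≠ w) : splitIdem F E v w w' = 0 := by simp [splitIdem, h]

omit [NumberField F] [Algebra.IsQuadraticExtension F E] in
/-- `e_w² = e_w`. [folklore] -/
private theorem splitIdem_mul_self (w : PlacesOver E v) : splitIdem F E v w * splitIdem F E v w = splitIdem F E v w := by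
  funext w'; by_cases h : w' = w <;> simp [splitIdem, h]

omit [Algebra.IsQuadraticExtension F E] in
/-- at a split place `c` moves `w`: `(c ⊗ 1)(e_w) · e_w = 0`. [folklore] -/
private theorem conjLocal_splitIdem_mul (w : PlacesOver E v) (hw : c • w.1 ≠ w.1) :
    conjLocal E c v (splitIdem F E v w) * splitIdem F E v w = 0 := by
  funext w'
  simp only [Pi.mul_apply, Pi.zero_apply, conjLocal_apply]
  by_cases h : w' = w
  · subst h
    have hne : (⟨c⁻¹ • w'.1, under_inv_smul_eq c w'⟩ : PlacesOver E v) ≠ w' := by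
      intro heq
      apply hw
      have := congrArg Subtype.val heq
      simp only at this
      -- `c⁻¹ • w = w` ⇒ `c • w = w`
      have h2 : c • (c⁻¹ • w'.1) = c • w'.1 := by rw [this]
      rw [smul_inv_smul] at h2
      exact h2.symm
    rw [splitIdem_apply_ne F E v hne, map_zero, zero_mul]
  · rw [splitIdem_apply_ne F E v h, mul_zero]

/-- `hermForm` is conjugate-linear ∕ linear in its two arguments: scaling both by `e` brings out `σ(e) e`.
[folklore] -/
private theorem hermForm_smul_smul {n : Type*} [Fintype n] {R' : Type*} [CommRing R'] (σ : R' →+* R') (H : Matrix n n R')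
    (e : R') (x y : n → R') :
    hermForm σ H (e • x) (e • y) = σ e * e * hermForm σ H x y := by
  simp only [hermForm_apply, Matrix.mulVec_smul, dotProduct_smul, smul_eq_mul]
  have : (⇑σ ∘ (e • x)) = σ e • (⇑σ ∘ x) := by
    funext i; simp [Pi.smul_apply, smul_eq_mul, map_mul]
  rw [this, smul_dotProduct, smul_eq_mul]
  ring

/-- `hermForm` is conjugate-linear in the first argument. [folklore] -/
private theorem hermForm_smul_left {n : Type*} [Fintype n] {R' : Type*} [CommRing R'] (σ : R' →+* R') (H : Matrix n n R')
    (e : R') (x y : n → R') :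
    hermForm σ H (e • x) y = σ e * hermForm σ H x y := by
  simp only [hermForm_apply]
  have : (⇑σ ∘ (e • x)) = σ e • (⇑σ ∘ x) := by
    funext i; simp [Pi.smul_apply, smul_eq_mul, map_mul]
  rw [this, smul_dotProduct, smul_eq_mul]

/-- `h(e_i, y) = (H y)_i`. [folklore] -/
private theorem hermForm_single {n : Type*} [Fintype n] [DecidableEq n] {R' : Type*} [CommRing R'] (σ : R' →+* R')
    (H : Matrix n n R') (i : n) (y : n → R') :
    hermForm σ H (Pi.single i 1) y = (H *ᵥ y) i := by
  rw [hermForm_apply]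
  have : (⇑σ ∘ Pi.single i (1 : R')) = Pi.single i 1 := by
    funext j
    rcases eq_or_ne j i with rfl | hj
    · rw [Function.comp_apply, Pi.single_eq_same, map_one]
    · rw [Function.comp_apply, Pi.single_eq_of_ne hj, map_zero]
  rw [this, single_dotProduct, one_mul]

/-- at a split place `e_w + (c ⊗ 1)(e_w) = 1` (the two places over `v` are `w` and `c⁻¹ w`). [folklore] -/
private theorem splitIdem_add_conjLocal (w : PlacesOver E v) (hw : c • w.1 ≠ w.1) :
    splitIdem F E v w + conjLocal E c v (splitIdem F E v w) = 1 := by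
  have hc : c ≠ 1 := by
    rintro rfl
    exact hw (one_smul _ _)
  funext w'
  simp only [Pi.add_apply, Pi.one_apply, conjLocal_apply]
  rcases PlacesOver.eq_or_eq_galInv c hc w w' with rfl | rfl
  · rw [splitIdem_apply_self, splitIdem_apply_ne F E v (PlacesOver.galInv_ne c w' hw), map_zero, add_zero]
  · rw [splitIdem_apply_ne F E v (PlacesOver.galInv_ne c w hw)]
    have : splitIdem F E v w ⟨c⁻¹ • (PlacesOver.galInv c w).1, under_inv_smul_eq c (PlacesOver.galInv c w)⟩ = 1 := by
      rw [splitIdem_apply, if_pos (PlacesOver.galInv_galInv c hc w)]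
    rw [this, map_one, zero_add]

/-! ## §2 The Lagrangian `reIm (e_w · (E ⊗ F_v)ᴺ)` -/

section Lagr

variable {T}

/-- the local quadratic coordinates `reIm` at `v` (`(E ⊗ F_v)ᴺ = F_vᴺ ⊕ F_vᴺ δ`). [folklore] -/
abbrev localReIm : (Fin N → S) ≃+ ((Fin N → K) × (Fin N → K)) :=
  QuadraticCoordinates.reIm (quadraticLocalEquiv E v c hcδ hδ).toLinearEquiv.toAddEquiv (Fin N)

include hd in
/-- `reIm (ι_v a • x) = a • reIm x`. [folklore] -/
private theorem localReIm_smul (a : K) (x : Fin N → S) :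
    localReIm F E c N hcδ hδ v (toLocalRing E v a • x) = a • localReIm F E c N hcδ hδ v x := by
  have h := isQuadraticCoordinates_local E v c hcδ hδ hd
  refine Prod.ext (funext fun i => ?_) (funext fun i => ?_)
  · simp only [localReIm, reIm_apply_fst, Pi.smul_apply, smul_eq_mul, Prod.smul_fst, h.re_map_mul]
  · simp only [localReIm, reIm_apply_snd, Pi.smul_apply, smul_eq_mul, Prod.smul_snd, h.im_map_mul]

include hd in
/-- **the `ι(U(J)(F_v))`-stable Lagrangian at a split place**: `reIm` of the `E ⊗ F_v`-submodule `e_w · (E ⊗ F_v)ᴺ`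
(the summand `X₁ ⊗ X₂` of the type II polarisation). [cite: MoeglinVignerasWaldspurger1987, Chap. 2 III.1] -/
def splitLagrangian (w : PlacesOver E v) : Submodule K ((Fin N → K) × (Fin N → K)) where
  carrier := {p | ∃ x : Fin N → S, splitIdem F E v w • x = x ∧ p = localReIm F E c N hcδ hδ v x}
  add_mem' := by
    rintro _ _ ⟨x, hx, rfl⟩ ⟨y, hy, rfl⟩
    exact ⟨x + y, by rw [smul_add, hx, hy], (map_add _ x y).symm⟩
  zero_mem' := ⟨0, smul_zero _, (map_zero _).symm⟩
  smul_mem' := by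
    rintro a _ ⟨x, hx, rfl⟩
    refine ⟨toLocalRing E v a • x, ?_, (localReIm_smul F E c N hcδ hδ hd v a x).symm⟩
    rw [smul_comm, hx]

/-- isotropy: `Im h(e x, e y) = Im ((c ⊗ 1)(e) e · h(x, y)) = 0`. [cite: MoeglinVignerasWaldspurger1987, Chap. 2 III.1] -/
theorem splitLagrangian_isotropic (hT : T.IsSymm) (w : PlacesOver E v) (hw : c • w.1 ≠ w.1)
    (p q : (Fin N → K) × (Fin N → K)) (hp : p ∈ splitLagrangian F E c N hcδ hδ hd v w)
    (hq : q ∈ splitLagrangian F E c N hcδ hδ hd v w) :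
    alt (polar (localPairing F N T v)) p q = 0 := by
  obtain ⟨x, hx, rfl⟩ := hp
  obtain ⟨y, hy, rfl⟩ := hq
  have h := isQuadraticCoordinates_local E v c hcδ hδ hd
  have key := h.im_hermForm_map (Fin N) (hT.map (algebraMap F K)) (σ := conjLocal E c v)
    (conjLocal_toLocalRing c v) (by rw [conjLocal_algebraMap, hcδ, map_neg]) x y
  rw [localReIm, ← key, ← hx, ← hy, hermForm_smul_smul, conjLocal_splitIdem_mul F E c v w hw, zero_mul, map_zero]

/-- the linear map underlying an element of `Sp(𝕎_v)` (for `Submodule.map`). [folklore] -/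
abbrev spLin (g : LocalSp F N T v) : ((Fin N → K) × (Fin N → K)) →ₗ[K] ((Fin N → K) × (Fin N → K)) :=
  ((g : ((Fin N → K) × (Fin N → K)) ≃ₗ[K] ((Fin N → K) × (Fin N → K))) : _ →ₗ[K] _)

/-- stability, `≤` half: `ι(g) m ≤ m` (`reIm (g x) = ι(g) (reIm x)` and `e (g x) = g (e x)`). [folklore] -/
private theorem splitLagrangian_map_le (hT : T.IsSymm) (w : PlacesOver E v) (g : UnitaryGroup.localPi E c N J v) :
    (splitLagrangian F E c N hcδ hδ hd v w).map (spLin F N v (iota F E c N hcδ hδ hd T hT hJ v g)) ≤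
      splitLagrangian F E c N hcδ hδ hd v w := by
  rw [Submodule.map_le_iff_le_comap]
  rintro _ ⟨x, hx, rfl⟩
  refine ⟨((localPiEquiv E c N J v g).1 : GL (Fin N) S).1 *ᵥ x, ?_, ?_⟩
  · conv_rhs => rw [← hx]
    rw [Matrix.mulVec_smul]
  · rw [iota_def]
    exact localToSymplectic_reIm E c N v hcδ hδ hd hT hJ (localPiEquiv E c N J v g) x

/-- **stability**: `ι(g) m = m` for every `g ∈ U(J)(F_v)` (`GL(X₁)` preserves `X₁ ⊗ X₂`).
[cite: MoeglinVignerasWaldspurger1987, Chap. 2 III.1] -/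
theorem splitLagrangian_map_iota (hT : T.IsSymm) (w : PlacesOver E v) (g : UnitaryGroup.localPi E c N J v) :
    (splitLagrangian F E c N hcδ hδ hd v w).map (spLin F N v (iota F E c N hcδ hδ hd T hT hJ v g)) =
      splitLagrangian F E c N hcδ hδ hd v w := by
  refine le_antisymm (splitLagrangian_map_le F E c N hcδ hδ hd hJ v hT w g) fun p hp => ?_
  refine ⟨spLin F N v (iota F E c N hcδ hδ hd T hT hJ v g⁻¹) p,
    splitLagrangian_map_le F E c N hcδ hδ hd hJ v hT w g⁻¹ ⟨p, hp, rfl⟩, ?_⟩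
  have h1 : iota F E c N hcδ hδ hd T hT hJ v g * iota F E c N hcδ hδ hd T hT hJ v g⁻¹ = 1 := by
    rw [← map_mul, mul_inv_cancel, map_one]
  show spLin F N v (iota F E c N hcδ hδ hd T hT hJ v g * iota F E c N hcδ hδ hd T hT hJ v g⁻¹) p = p
  rw [h1]
  rfl

/-- **maximality**: `m^⊥ ≤ m`.  For `z = reIm y ∈ m^⊥`, testing against `e • e_i` and `δ e • e_i` gives
`Im (σ(e) (Hy)_i) = Re (σ(e) (Hy)_i) = 0`, so `H (σ(e) y) = 0`, `σ(e) y = 0` (`H` invertible) and `y = (e + σ e) y = e y`.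
[cite: MoeglinVignerasWaldspurger1987, Chap. 2 III.1] -/
theorem splitLagrangian_orthogonal_le (hT : T.IsSymm) (hTd : IsUnit T.det) (w : PlacesOver E v) (hw : c • w.1 ≠ w.1) :
    LinearMap.BilinForm.orthogonal (alt (polar (localPairing F N T v))) (splitLagrangian F E c N hcδ hδ hd v w) ≤
      splitLagrangian F E c N hcδ hδ hd v w := by
  intro z hz
  rw [LinearMap.BilinForm.mem_orthogonal_iff] at hz
  have h := isQuadraticCoordinates_local E v c hcδ hδ hd
  obtain ⟨y, rfl⟩ : ∃ y, z = localReIm F E c N hcδ hδ v y :=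
    ⟨(localReIm F E c N hcδ hδ v).symm z, (AddEquiv.apply_symm_apply _ z).symm⟩
  refine ⟨y, ?_, rfl⟩
  have hσφ := conjLocal_toLocalRing (E := E) c v
  have hσδ : conjLocal E c v (algebraMap E S δ) = -algebraMap E S δ := by rw [conjLocal_algebraMap, hcδ, map_neg]
  -- step 1: `im (σ(e) h(x, y)) = 0` for every `x`
  have step1 : ∀ x : Fin N → S, QuadraticCoordinates.im Ψv
      (conjLocal E c v (splitIdem F E v w) * hermForm (conjLocal E c v) ((T.map (algebraMap F K)).map (toLocalRing E v)) x y) = 0 := by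
    intro x
    have hmem : localReIm F E c N hcδ hδ v (splitIdem F E v w • x) ∈ splitLagrangian F E c N hcδ hδ hd v w :=
      ⟨splitIdem F E v w • x, by rw [smul_smul, splitIdem_mul_self], rfl⟩
    have h0 : alt (polar (localPairing F N T v)) (localReIm F E c N hcδ hδ v (splitIdem F E v w • x))
        (localReIm F E c N hcδ hδ v y) = 0 := hz _ hmem
    rw [localReIm, ← h.im_hermForm_map (Fin N) (hT.map (algebraMap F K)) hσφ hσδ, hermForm_smul_left] at h0
    exact h0
  -- step 2: basis vectors and `δ` times basis vectors
  have step2a : ∀ i, QuadraticCoordinates.im Ψv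
      (conjLocal E c v (splitIdem F E v w) * (((T.map (algebraMap F K)).map (toLocalRing E v)) *ᵥ y) i) = 0 := fun i => by
    simpa only [hermForm_single] using step1 (Pi.single i 1)
  have step2b : ∀ i, QuadraticCoordinates.im Ψv (algebraMap E S δ *
      (conjLocal E c v (splitIdem F E v w) * (((T.map (algebraMap F K)).map (toLocalRing E v)) *ᵥ y) i)) = 0 := by
    intro i
    have h1 := step1 (algebraMap E S δ • Pi.single i 1)
    rw [hermForm_smul_left, hermForm_single, hσδ] at h1
    have : conjLocal E c v (splitIdem F E v w) * (-algebraMap E S δ * (((T.map (algebraMap F K)).map (toLocalRing E v)) *ᵥ y) i) =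
        -(algebraMap E S δ * (conjLocal E c v (splitIdem F E v w) * (((T.map (algebraMap F K)).map (toLocalRing E v)) *ᵥ y) i)) := by
      ring
    rwa [this, map_neg, neg_eq_zero] at h1
  -- step 3: `im s = 0 ∧ im (δ s) = 0 ⇒ s = 0`
  have C : ∀ s : S, QuadraticCoordinates.im Ψv s = 0 → QuadraticCoordinates.im Ψv (algebraMap E S δ * s) = 0 → s = 0 := by
    intro s h1 h2
    have e1 := h.re_add_im s
    rw [h1, map_zero, zero_mul, add_zero] at e1
    rw [← e1, mul_comm] at h2
    have e2 : QuadraticCoordinates.im Ψv (toLocalRing E v (QuadraticCoordinates.re Ψv s) * algebraMap E S δ) =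
        QuadraticCoordinates.re Ψv s := by
      simpa only [map_zero, zero_add] using h.im_eq 0 (QuadraticCoordinates.re Ψv s)
    rw [e2] at h2
    rw [← e1, h2, map_zero]
  have step3 : ((T.map (algebraMap F K)).map (toLocalRing E v)) *ᵥ (conjLocal E c v (splitIdem F E v w) • y) = 0 := by
    funext i
    rw [Matrix.mulVec_smul, Pi.smul_apply, smul_eq_mul, Pi.zero_apply]
    exact C _ (step2a i) (step2b i)
  -- step 4: `H` is invertible
  have hdet : IsUnit ((T.map (algebraMap F K)).map (toLocalRing E v)).det := by
    have hu := (hTd.map (algebraMap F K)).map (toLocalRing E v)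
    rw [RingHom.map_det, RingHom.map_det, RingHom.mapMatrix_apply, RingHom.mapMatrix_apply] at hu
    exact hu
  have step4 : conjLocal E c v (splitIdem F E v w) • y = 0 := by
    have h1 : ((T.map (algebraMap F K)).map (toLocalRing E v))⁻¹ *ᵥ
        (((T.map (algebraMap F K)).map (toLocalRing E v)) *ᵥ (conjLocal E c v (splitIdem F E v w) • y)) =
        conjLocal E c v (splitIdem F E v w) • y := by
      rw [Matrix.mulVec_mulVec, Matrix.nonsing_inv_mul _ hdet, Matrix.one_mulVec]
    rw [← h1, step3, Matrix.mulVec_zero]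
  -- step 5: `y = (e + σ e) y = e y`
  calc splitIdem F E v w • y = splitIdem F E v w • y + conjLocal E c v (splitIdem F E v w) • y := by rw [step4, add_zero]
    _ = (splitIdem F E v w + conjLocal E c v (splitIdem F E v w)) • y := (add_smul _ _ _).symm
    _ = y := by rw [splitIdem_add_conjLocal F E c v w hw, one_smul]

/-- **`reIm (e_w · (E ⊗ F_v)ᴺ)` is a Lagrangian**: `m^⊥ = m`. [cite: MoeglinVignerasWaldspurger1987, Chap. 2 III.1] -/
theorem splitLagrangian_orthogonal_eq (hT : T.IsSymm) (hTd : IsUnit T.det) (w : PlacesOver E v) (hw : c • w.1 ≠ w.1) :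
    LinearMap.BilinForm.orthogonal (alt (polar (localPairing F N T v))) (splitLagrangian F E c N hcδ hδ hd v w) =
      splitLagrangian F E c N hcδ hδ hd v w :=
  le_antisymm (splitLagrangian_orthogonal_le F E c N hcδ hδ hd v hT hTd w hw) fun p hp =>
    LinearMap.BilinForm.mem_orthogonal_iff.2 fun q hq =>
      splitLagrangian_isotropic F E c N hcδ hδ hd v hT w hw q p hq hp

/-- **At a place split in `E/F` there is an `ι(U(J)(F_v))`-stable Lagrangian of `𝕎_v`** (type II polarisation;
the split-place half of [Kudla1994, Thm 3.1]). [cite: MoeglinVignerasWaldspurger1987, Chap. 2 III.1] -/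
theorem exists_stable_lagrangian_of_split (hT : T.IsSymm) (hTd : IsUnit T.det) (w : PlacesOver E v)
    (hw : c • w.1 ≠ w.1) :
    ∃ m : Submodule (v.adicCompletion F) ((Fin N → v.adicCompletion F) × (Fin N → v.adicCompletion F)),
      LinearMap.BilinForm.orthogonal (alt (polar (localPairing F N T v))) m = m ∧
        ∀ g : UnitaryGroup.localPi E c N J v, m.map (spLin F N v (iota F E c N hcδ hδ hd T hT hJ v g)) = m :=
  ⟨splitLagrangian F E c N hcδ hδ hd v w, splitLagrangian_orthogonal_eq F E c N hcδ hδ hd v hT hTd w hw,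
    fun g => splitLagrangian_map_iota F E c N hcδ hδ hd hJ v hT w g⟩

end Lagr

end Literature.NumberTheory.GelbartRogawski1991.UnitaryDualPair.LocalSplitting
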